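import Mathlib

/-!
# `OrbitDimensionBound` (stmt-ValiantsHypothesis-16133), rung line `no_minor_covering` — stub `stub_kernelCycle`, part A:
# the COMBINATORIAL core (orbit of the kernel column under the Leibniz permutation)

Toolkit for `Theorems/FreeSubtorusOrbitDimensionBoundStubKernelCycle.lean`.  Abstract setting: a permutation `π` of the `m`
columns, an injection `τ : [n] ↪ [m]` (the columns carrying a variable), the kernel column `j₀ ∈ range τ`, column / row
weights `α, β : [m] → ℂ` with `β = α` off `j₀`, `α ≠ 0`, per-variable weights `cσ : [n] → ℂ`, the GRADING relations
`β (π (τ k)) = cσ k · α (τ k)` and `π j = j` off `range τ`, and the NO-MINOR hypothesis «no non-empty proper `M ⊆ [n]` has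
`∏_{k ∈ M} cσ k = 1`».  Results: `range τ` is `π`-stable (`perm_mem_range`, `perm_symm_mem_range`); every `π`-invariant
`T ⊆ range τ ∖ {j₀}` is EMPTY (`invariant_eq_empty`, telescoping); hence the `π`-orbit of `j₀` is all of `range τ` and, along
it, `β (π^s j₀) = α j₀ · ∏_{t < s} cσ k_t` for `1 ≤ s ≤ n` (`kernelCycle_comb`).

Helper mode (`--supports stmt-ValiantsHypothesis-16133 --as helper`); no definitions.  Honest framing: bookkeeping for a
dormant rung line; `OrbitDimensionBound`, `FreeSubtorus` and VP ≠ VNP are OPEN and not moved.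
-/

open Finset

-- the mandated summit-side namespace repeats a component by design (single-problem summit)
set_option linter.dupNamespace false

namespace Summit.ValiantsHypothesis.ValiantsHypothesis.Theorems.FreeSubtorusOrbitDimensionBound.KernelCycle

variable {m n : ℕ}

/-- If `π` fixes every column off `range τ`, it maps `range τ` into itself. [folklore] -/
theorem perm_mem_range (π : Equiv.Perm (Fin m)) (τ : Fin n ↪ Fin m) (hF3 : ∀ j, j ∉ Set.range τ → π j = j)
    {j : Fin m} (hj : j ∈ Set.range τ) : π j ∈ Set.range τ := by
  by_contra h
  have h1 : π (π j) = π j := hF3 _ h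
  have h2 : π j = j := π.injective h1
  rw [h2] at h
  exact h hj

/-- … and so does `π⁻¹`. [folklore] -/
theorem perm_symm_mem_range (π : Equiv.Perm (Fin m)) (τ : Fin n ↪ Fin m) (hF3 : ∀ j, j ∉ Set.range τ → π j = j)
    {j : Fin m} (hj : j ∈ Set.range τ) : π.symm j ∈ Set.range τ := by
  by_contra h
  have h1 : π (π.symm j) = π.symm j := hF3 _ h
  rw [Equiv.apply_symm_apply] at h1
  rw [← h1] at h
  exact h hj

/-- **No invariant proper sub-matching.**  Under the grading relations and the no-minor hypothesis, a `π`-invariant set of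
variable columns avoiding the kernel column is empty (telescoping the weights around `T`). [folklore] -/
theorem invariant_eq_empty (π : Equiv.Perm (Fin m)) (τ : Fin n ↪ Fin m) (j₀ : Fin m) (α β : Fin m → ℂ) (cσ : Fin n → ℂ)
    (hα : ∀ j, α j ≠ 0) (hβα : ∀ j, j ≠ j₀ → β j = α j) (hF2 : ∀ k, β (π (τ k)) = cσ k * α (τ k))
    (hj₀ : j₀ ∈ Set.range τ)
    (hσ : ∀ M : Finset (Fin n), M.Nonempty → M ≠ Finset.univ → (∏ k ∈ M, cσ k) ≠ 1)
    (T : Finset (Fin m)) (hTR : ∀ j ∈ T, j ∈ Set.range τ) (hTj₀ : j₀ ∉ T) (hTπ : ∀ j ∈ T, π j ∈ T) : T = ∅ := by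
  classical
  by_contra hne
  have hT : T.Nonempty := Finset.nonempty_iff_ne_empty.mpr hne
  -- `T = τ(M)`
  set M : Finset (Fin n) := Finset.univ.filter (fun k => τ k ∈ T) with hM
  have hTmap : T = M.map τ := by
    ext j
    simp only [Finset.mem_map, hM, Finset.mem_filter, Finset.mem_univ, true_and]
    constructor
    · intro hj
      obtain ⟨k, rfl⟩ := hTR j hj
      exact ⟨k, hj, rfl⟩
    · rintro ⟨k, hk, rfl⟩
      exact hk
  -- `π(T) = T`
  have himage : T.image π = T := by
    apply Finset.eq_of_subset_of_card_le
    · intro x hx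
      obtain ⟨j, hj, rfl⟩ := Finset.mem_image.mp hx
      exact hTπ j hj
    · rw [Finset.card_image_of_injective _ π.injective]
  -- telescoping
  have h1 : ∏ j ∈ T, β (π j) = ∏ j ∈ T, β j := by
    rw [← Finset.prod_image (f := β) (fun x _ y _ h => π.injective h), himage]
  have h2 : ∏ j ∈ T, β (π j) = (∏ k ∈ M, cσ k) * ∏ k ∈ M, α (τ k) := by
    rw [hTmap, Finset.prod_map, ← Finset.prod_mul_distrib]
    exact Finset.prod_congr rfl fun k _ => hF2 k
  have h3 : ∏ j ∈ T, β j = ∏ k ∈ M, α (τ k) := by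
    rw [hTmap, Finset.prod_map]
    refine Finset.prod_congr rfl fun k hk => hβα _ ?_
    rintro h
    rw [hM, Finset.mem_filter] at hk
    exact hTj₀ (h ▸ hk.2)
  have hX : ∏ k ∈ M, α (τ k) ≠ 0 := Finset.prod_ne_zero_iff.mpr fun k _ => hα _
  have hprod : ∏ k ∈ M, cσ k = 1 := by
    have := h2.symm.trans (h1.trans h3)
    exact (mul_eq_right₀ hX).mp this
  -- `M` is non-empty and proper
  have hMne : M.Nonempty := by
    rw [hTmap] at hT; exact (Finset.map_nonempty).mp hT
  have hMuniv : M ≠ Finset.univ := by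
    obtain ⟨k₁, hk₁⟩ := hj₀
    intro h
    have : k₁ ∈ M := h ▸ Finset.mem_univ k₁
    rw [hM, Finset.mem_filter, hk₁] at this
    exact hTj₀ this.2
  exact hσ M hMne hMuniv hprod

/-- **The kernel cycle reads every variable.**  Along the `π`-orbit of the kernel column `j₀` — which is ALL of `range τ` —
the weights telescope: for every `1 ≤ i ≤ n` some `i`-set `I` of variables and some row `i'` have
`β i' = α j₀ · ∏_{k ∈ I} cσ k`. [folklore] -/
theorem kernelCycle_comb (π : Equiv.Perm (Fin m)) (τ : Fin n ↪ Fin m) (j₀ : Fin m) (α β : Fin m → ℂ) (cσ : Fin n → ℂ)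
    (hα : ∀ j, α j ≠ 0) (hβα : ∀ j, j ≠ j₀ → β j = α j) (hF2 : ∀ k, β (π (τ k)) = cσ k * α (τ k))
    (hF3 : ∀ j, j ∉ Set.range τ → π j = j) (hj₀ : j₀ ∈ Set.range τ)
    (hσ : ∀ M : Finset (Fin n), M.Nonempty → M ≠ Finset.univ → (∏ k ∈ M, cσ k) ≠ 1) :
    ∀ i : ℕ, 1 ≤ i → i ≤ n → ∃ I : Finset (Fin n), I.card = i ∧ ∃ i' : Fin m, β i' = α j₀ * ∏ k ∈ I, cσ k := by
  classical
  -- the orbit of `j₀`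
  set p : ℕ := Function.minimalPeriod π j₀ with hp
  have hp0 : 0 < p := Function.minimalPeriod_pos_of_mem_periodicPts (π.injective.mem_periodicPts j₀)
  set js : ℕ → Fin m := fun s => (⇑π)^[s] j₀ with hjs
  have hjs_succ : ∀ s, π (js s) = js (s + 1) := fun s => by
    simp only [hjs, Function.iterate_succ_apply']
  have hjs_p : js p = j₀ := Function.iterate_minimalPeriod
  have hjsR : ∀ s, js s ∈ Set.range τ := by
    intro s
    induction s with
    | zero => simpa [hjs] using hj₀
    | succ s ih => rw [← hjs_succ]; exact perm_mem_range π τ hF3 ih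
  have hjs_inj : ∀ s t, s < p → t < p → js s = js t → s = t := fun s t hs ht h =>
    (Function.iterate_eq_iterate_iff_of_lt_minimalPeriod hs ht).mp h
  set O : Finset (Fin m) := (Finset.range p).image js with hO
  have hOπ : ∀ j ∈ O, π j ∈ O := by
    intro j hj
    obtain ⟨s, hs, rfl⟩ := Finset.mem_image.mp hj
    rw [Finset.mem_range] at hs
    rw [hjs_succ]
    by_cases h : s + 1 < p
    · exact Finset.mem_image.mpr ⟨s + 1, Finset.mem_range.mpr h, rfl⟩
    · have : s + 1 = p := by omega
      rw [this, hjs_p]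
      exact Finset.mem_image.mpr ⟨0, Finset.mem_range.mpr hp0, rfl⟩
  have hOsymm : ∀ j ∈ O, π.symm j ∈ O := by
    intro j hj
    obtain ⟨s, hs, rfl⟩ := Finset.mem_image.mp hj
    rw [Finset.mem_range] at hs
    rcases Nat.eq_zero_or_pos s with h0 | hpos
    · subst h0
      have : π.symm (js 0) = js (p - 1) := by
        rw [Equiv.symm_apply_eq, hjs_succ, Nat.sub_add_cancel hp0, hjs_p]
        show (⇑π)^[0] j₀ = j₀
        rw [Function.iterate_zero_apply]
      rw [this]
      exact Finset.mem_image.mpr ⟨p - 1, Finset.mem_range.mpr (by omega), rfl⟩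
    · have : π.symm (js s) = js (s - 1) := by
        rw [Equiv.symm_apply_eq, hjs_succ, Nat.sub_add_cancel hpos]
      rw [this]
      exact Finset.mem_image.mpr ⟨s - 1, Finset.mem_range.mpr (by omega), rfl⟩
  -- `range τ ⊆ O` by the invariant-set lemma applied to `range τ ∖ O`
  set Rset : Finset (Fin m) := Finset.univ.map τ with hRset
  have hRmem : ∀ j, j ∈ Rset ↔ j ∈ Set.range τ := by
    intro j; simp [hRset, Set.mem_range]
  have hT := invariant_eq_empty π τ j₀ α β cσ hα hβα hF2 hj₀ hσ (Rset \ O)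
    (fun j hj => (hRmem j).mp (Finset.mem_sdiff.mp hj).1)
    (by
      rw [Finset.mem_sdiff, not_and, not_not]
      intro _
      exact Finset.mem_image.mpr ⟨0, Finset.mem_range.mpr hp0, rfl⟩)
    (by
      intro j hj
      rw [Finset.mem_sdiff] at hj ⊢
      refine ⟨(hRmem _).mpr (perm_mem_range π τ hF3 ((hRmem j).mp hj.1)), fun h => hj.2 ?_⟩
      have := hOsymm _ h
      rwa [Equiv.symm_apply_apply] at this)
  have hRO : Rset ⊆ O := Finset.sdiff_eq_empty_iff_subset.mp hT
  have hnp : n ≤ p := by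
    calc n = Rset.card := by rw [hRset, Finset.card_map, Finset.card_univ, Fintype.card_fin]
      _ ≤ O.card := Finset.card_le_card hRO
      _ ≤ (Finset.range p).card := Finset.card_image_le
      _ = p := Finset.card_range p
  -- the variables along the orbit
  choose kf hkf using hjsR
  have hkf_inj : ∀ s t, s < p → t < p → kf s = kf t → s = t := by
    intro s t hs ht h
    apply hjs_inj s t hs ht
    rw [← hkf s, ← hkf t, h]
  -- telescoping along the orbit
  have hQ : ∀ s, 1 ≤ s → s ≤ p → β (js s) = α j₀ * ∏ t ∈ Finset.range s, cσ (kf t) := by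
    intro s hs1 hsp
    induction s with
    | zero => omega
    | succ s ih =>
      rw [← hjs_succ, ← hkf s, hF2, Finset.prod_range_succ]
      rcases Nat.eq_zero_or_pos s with h0 | hpos
      · subst h0
        simp [hkf 0, hjs]
        ring
      · rw [hkf s, ← hβα (js s) ?_, ih hpos (by omega)]
        · ring
        · intro h
          have := hjs_inj s 0 (by omega) hp0 (by rw [h]; rfl)
          omega
  -- conclusion
  intro i hi1 hin
  refine ⟨(Finset.range i).image kf, ?_, js i, ?_⟩
  · rw [Finset.card_image_of_injOn, Finset.card_range]
    intro s hs t ht h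
    exact hkf_inj s t (by simp at hs; omega) (by simp at ht; omega) h
  · rw [Finset.prod_image]
    · exact hQ i hi1 (hin.trans hnp)
    · intro s hs t ht h
      exact hkf_inj s t (by simp at hs; omega) (by simp at ht; omega) h

end Summit.ValiantsHypothesis.ValiantsHypothesis.Theorems.FreeSubtorusOrbitDimensionBound.KernelCycle
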